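import Mathlib
import Summits.MatrixMultiplication.MatrixMultiplication.Theses.LevelGradedCohnUmans
import Summits.MatrixMultiplication.MatrixMultiplication.Theorems.LieRankDesigns.Negative.Basics

/-!
# Stub `stub_flag_tpp_criterion` — line `Sketch` of the crux `LevelOneGL2Designs`
(stmt-MatrixMultiplication-14080)

The flag criterion: for the central chunks `X = C₁·U` (upper unitriangular matrices times
scalars from `C₁`) and `Z = C₂·U⁻` (lower unitriangular matrices times scalars from `C₂`) of
`GL₂(𝔽_p)`, with co-Sidon ratio sets `C₁, C₂ ⊆ 𝔽_p^×`, the quadruple-form triple product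
property of `(X, K, Z)` is the determinant-graded flag-code condition on the middle set `K`:
no ordered pair `k ≠ k'` in `K` has `w² = det k · det k'` and `w ∈ det k' · C₁C₁⁻¹C₂C₂⁻¹`, where
`w = k₁₁ k'₀₀ - k₁₀ k'₀₁ = det k' · (k k'⁻¹)₁₁`.  Pure `2 × 2` matrix algebra:

* `Q(X) ∩ Q(Z) = {1}` always holds here (`apart`), so TPP reduces to `Q(K) ∩ Q(X)Q(Z) = {1}`;
* `Q(X)Q(Z) = {g : g₁₁ = Γ, det g = Γ², Γ ∈ C₁C₁⁻¹C₂C₂⁻¹}` (`quot_prod_shape`, `realize`);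
* for `g = k k'⁻¹`: `g₁₁ = w / det k'` and `det g = det k / det k'` (`quot_shape_iff`).
-/

set_option linter.dupNamespace false

noncomputable section

open scoped BigOperators

namespace Summit.MatrixMultiplication.MatrixMultiplication.Theorems.LevelOneGL2Designs.FlagLine

open Summit.MatrixMultiplication.MatrixMultiplication.Theses.LevelGradedCohnUmans
open Summit.MatrixMultiplication.MatrixMultiplication.Theorems.LieRankDesigns.Negative

section Flag

variable {p : ℕ} [Fact p.Prime]

/-! ### Entries of inverses and quotients in `GL₂(𝔽_p)` -/

/-- The inverse of `g ∈ GL₂(𝔽_p)` as a matrix: `(det g)⁻¹ · adj g` (adjugate formula). -/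
private theorem coe_inv_fin_two (g : GLm p 2) :
    ((g⁻¹ : GLm p 2) : Mat p 2) =
      ((g : Mat p 2).det)⁻¹ • !![(g : Mat p 2) 1 1, -(g : Mat p 2) 0 1;
                                 -(g : Mat p 2) 1 0, (g : Mat p 2) 0 0] := by
  rw [Matrix.coe_units_inv, Matrix.inv_def, Ring.inverse_eq_inv, Matrix.adjugate_fin_two]

/-- The four entries of the inverse of `g ∈ GL₂(𝔽_p)`. -/
private theorem inv_apply_fin_two (g : GLm p 2) :
    ((g⁻¹ : GLm p 2) : Mat p 2) 0 0 = ((g : Mat p 2).det)⁻¹ * (g : Mat p 2) 1 1 ∧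
    ((g⁻¹ : GLm p 2) : Mat p 2) 0 1 = -(((g : Mat p 2).det)⁻¹ * (g : Mat p 2) 0 1) ∧
    ((g⁻¹ : GLm p 2) : Mat p 2) 1 0 = -(((g : Mat p 2).det)⁻¹ * (g : Mat p 2) 1 0) ∧
    ((g⁻¹ : GLm p 2) : Mat p 2) 1 1 = ((g : Mat p 2).det)⁻¹ * (g : Mat p 2) 0 0 := by
  rw [coe_inv_fin_two]
  simp

/-- The determinant of a quotient `k k'⁻¹` in `GL₂(𝔽_p)`. -/
private theorem det_mul_inv (k k' : GLm p 2) :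
    ((k * k'⁻¹ : GLm p 2) : Mat p 2).det = (k : Mat p 2).det * ((k' : Mat p 2).det)⁻¹ := by
  rw [Matrix.GeneralLinearGroup.coe_mul, Matrix.det_mul, Matrix.coe_units_inv,
    Matrix.det_nonsing_inv, Ring.inverse_eq_inv]

/-- The `(1,1)` entry of a quotient `k k'⁻¹` in `GL₂(𝔽_p)`:
`(k k'⁻¹)₁₁ = (k₁₁ k'₀₀ - k₁₀ k'₀₁) / det k'`. -/
private theorem mul_inv_apply_one_one (k k' : GLm p 2) :
    ((k * k'⁻¹ : GLm p 2) : Mat p 2) 1 1 =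
      ((k : Mat p 2) 1 1 * (k' : Mat p 2) 0 0 - (k : Mat p 2) 1 0 * (k' : Mat p 2) 0 1) *
        ((k' : Mat p 2).det)⁻¹ := by
  obtain ⟨-, h01, -, h11⟩ := inv_apply_fin_two k'
  rw [Matrix.GeneralLinearGroup.coe_mul, Matrix.mul_apply, Fin.sum_univ_two, h01, h11]
  ring

/-- **Key reformulation.**  For `k, k' ∈ GL₂(𝔽_p)` and a scalar `Γ`, the quotient `g = k k'⁻¹`
has `g₁₁ = Γ` and `det g = Γ²` iff `w² = det k · det k'` and `w = det k' · Γ`, where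
`w = k₁₁ k'₀₀ - k₁₀ k'₀₁`. -/
private theorem quot_shape_iff (k k' : GLm p 2) (Γ : ZMod p) :
    (((k * k'⁻¹ : GLm p 2) : Mat p 2) 1 1 = Γ ∧
        ((k * k'⁻¹ : GLm p 2) : Mat p 2).det = Γ ^ 2) ↔
      (((k : Mat p 2) 1 1 * (k' : Mat p 2) 0 0 - (k : Mat p 2) 1 0 * (k' : Mat p 2) 0 1) ^ 2
            = (k : Mat p 2).det * (k' : Mat p 2).det ∧
        ((k : Mat p 2) 1 1 * (k' : Mat p 2) 0 0 - (k : Mat p 2) 1 0 * (k' : Mat p 2) 0 1)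
            = (k' : Mat p 2).det * Γ) := by
  have hD : (k' : Mat p 2).det ≠ 0 := Matrix.GeneralLinearGroup.det_ne_zero k'
  rw [mul_inv_apply_one_one, det_mul_inv]
  generalize (k : Mat p 2) 1 1 * (k' : Mat p 2) 0 0 - (k : Mat p 2) 1 0 * (k' : Mat p 2) 0 1 = w
  generalize (k : Mat p 2).det = E
  generalize hD' : (k' : Mat p 2).det = D
  rw [hD'] at hD
  constructor
  · rintro ⟨h1, h2⟩
    have hw : w = D * Γ := by
      rw [← h1]; field_simp
    refine ⟨?_, hw⟩
    have hE : E = D * Γ ^ 2 := by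
      rw [← h2]; field_simp
    rw [hw, hE]; ring
  · rintro ⟨h1, h2⟩
    have hE : E = D * Γ ^ 2 := by
      rw [h2] at h1
      have : D * (E - D * Γ ^ 2) = 0 := by linear_combination -h1
      rcases mul_eq_zero.mp this with h | h
      · exact absurd h hD
      · exact sub_eq_zero.mp h
    rw [h2, hE]
    constructor
    · field_simp
    · field_simp

/-! ### The shapes `X = C₁·U` (upper) and `Z = C₂·U⁻` (lower) -/

/-- Quotient `x x₀⁻¹` of two invertible upper-triangular matrices with scalar diagonal: it is
again upper triangular with both diagonal entries `x₀₀ / (x₀)₀₀`. -/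
private theorem upper_quot {x x₀ : GLm p 2}
    (h10 : (x : Mat p 2) 1 0 = 0) (h00 : (x : Mat p 2) 0 0 = (x : Mat p 2) 1 1)
    (k10 : (x₀ : Mat p 2) 1 0 = 0) (k00 : (x₀ : Mat p 2) 0 0 = (x₀ : Mat p 2) 1 1) :
    ((x * x₀⁻¹ : GLm p 2) : Mat p 2) 1 0 = 0 ∧
    ((x * x₀⁻¹ : GLm p 2) : Mat p 2) 0 0 = (x : Mat p 2) 0 0 * ((x₀ : Mat p 2) 0 0)⁻¹ ∧
    ((x * x₀⁻¹ : GLm p 2) : Mat p 2) 1 1 = (x : Mat p 2) 0 0 * ((x₀ : Mat p 2) 0 0)⁻¹ := by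
  have hd : (x₀ : Mat p 2).det ≠ 0 := Matrix.GeneralLinearGroup.det_ne_zero x₀
  have ha₀ : (x₀ : Mat p 2) 1 1 ≠ 0 := by
    intro h
    apply hd
    rw [Matrix.det_fin_two, h, k10]; ring
  obtain ⟨i00, i01, i10, i11⟩ := inv_apply_fin_two x₀
  rw [Matrix.GeneralLinearGroup.coe_mul, Matrix.mul_apply, Matrix.mul_apply, Matrix.mul_apply,
    Fin.sum_univ_two, Fin.sum_univ_two, Fin.sum_univ_two, i00, i01, i10, i11, Matrix.det_fin_two,
    h10, k10, h00, k00]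
  refine ⟨by ring, ?_, ?_⟩
  · field_simp
    ring
  · field_simp
    ring

/-- Quotient `z₀ z⁻¹` of two invertible lower-triangular matrices with scalar diagonal: it is
again lower triangular with both diagonal entries `(z₀)₀₀ / z₀₀`. -/
private theorem lower_quot {z₀ z : GLm p 2}
    (h01 : (z₀ : Mat p 2) 0 1 = 0) (h00 : (z₀ : Mat p 2) 0 0 = (z₀ : Mat p 2) 1 1)
    (k01 : (z : Mat p 2) 0 1 = 0) (k00 : (z : Mat p 2) 0 0 = (z : Mat p 2) 1 1) :
    ((z₀ * z⁻¹ : GLm p 2) : Mat p 2) 0 1 = 0 ∧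
    ((z₀ * z⁻¹ : GLm p 2) : Mat p 2) 0 0 = (z₀ : Mat p 2) 0 0 * ((z : Mat p 2) 0 0)⁻¹ ∧
    ((z₀ * z⁻¹ : GLm p 2) : Mat p 2) 1 1 = (z₀ : Mat p 2) 0 0 * ((z : Mat p 2) 0 0)⁻¹ := by
  have hd : (z : Mat p 2).det ≠ 0 := Matrix.GeneralLinearGroup.det_ne_zero z
  have hd₀ : (z : Mat p 2) 1 1 ≠ 0 := by
    intro h
    apply hd
    rw [Matrix.det_fin_two, h, k01]; ring
  obtain ⟨i00, i01, i10, i11⟩ := inv_apply_fin_two z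
  rw [Matrix.GeneralLinearGroup.coe_mul, Matrix.mul_apply, Matrix.mul_apply, Matrix.mul_apply,
    Fin.sum_univ_two, Fin.sum_univ_two, Fin.sum_univ_two, i00, i01, i10, i11, Matrix.det_fin_two,
    h01, k01, h00, k00]
  refine ⟨by ring, ?_, ?_⟩
  · field_simp
    ring
  · field_simp
    ring

/-- Product of an upper-triangular and a lower-triangular `2 × 2` matrix: its `(1,1)` entry and
its determinant. -/
private theorem upper_mul_lower (S T : Mat p 2) (hS : S 1 0 = 0) (hT : T 0 1 = 0) :
    (S * T) 1 1 = S 1 1 * T 1 1 ∧ (S * T).det = (S 0 0 * S 1 1) * (T 0 0 * T 1 1) := by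
  constructor
  · rw [Matrix.mul_apply, Fin.sum_univ_two, hS]; ring
  · rw [Matrix.det_mul, Matrix.det_fin_two, Matrix.det_fin_two, hS, hT]; ring

/-- **`Q(X)Q(Z) ⊆ Γ·UU⁻`.**  For `x, x₀` of `X`-shape and `z₀, z` of `Z`-shape the product
`g = x x₀⁻¹ · z₀ z⁻¹` has `g₁₁ = Γ` and `det g = Γ²` with `Γ = (x₀₀/(x₀)₀₀)·((z₀)₀₀/z₀₀)`. -/
private theorem quot_prod_shape {x x₀ z₀ z : GLm p 2}
    (h10 : (x : Mat p 2) 1 0 = 0) (h00 : (x : Mat p 2) 0 0 = (x : Mat p 2) 1 1)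
    (k10 : (x₀ : Mat p 2) 1 0 = 0) (k00 : (x₀ : Mat p 2) 0 0 = (x₀ : Mat p 2) 1 1)
    (l01 : (z₀ : Mat p 2) 0 1 = 0) (l00 : (z₀ : Mat p 2) 0 0 = (z₀ : Mat p 2) 1 1)
    (m01 : (z : Mat p 2) 0 1 = 0) (m00 : (z : Mat p 2) 0 0 = (z : Mat p 2) 1 1) :
    ((x * x₀⁻¹ * (z₀ * z⁻¹) : GLm p 2) : Mat p 2) 1 1 =
        (x : Mat p 2) 0 0 * ((x₀ : Mat p 2) 0 0)⁻¹ *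
          ((z₀ : Mat p 2) 0 0 * ((z : Mat p 2) 0 0)⁻¹) ∧
      ((x * x₀⁻¹ * (z₀ * z⁻¹) : GLm p 2) : Mat p 2).det =
        ((x : Mat p 2) 0 0 * ((x₀ : Mat p 2) 0 0)⁻¹ *
          ((z₀ : Mat p 2) 0 0 * ((z : Mat p 2) 0 0)⁻¹)) ^ 2 := by
  obtain ⟨u10, u00, u11⟩ := upper_quot h10 h00 k10 k00
  obtain ⟨v01, v00, v11⟩ := lower_quot l01 l00 m01 m00
  obtain ⟨e11, edet⟩ := upper_mul_lower _ _ u10 v01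
  rw [Matrix.GeneralLinearGroup.coe_mul (x * x₀⁻¹) (z₀ * z⁻¹), e11, edet, u00, u11, v00, v11]
  exact ⟨rfl, by ring⟩

/-- **`Q(X) ∩ Q(Z) = {1}`** for the shapes `X = C₁·U`, `Z = C₂·U⁻` with co-Sidon `C₁, C₂`:
`x x₀⁻¹ = z z₀⁻¹` forces `x = x₀` and `z = z₀`. -/
private theorem apart {C₁ C₂ : Finset (ZMod p)}
    (hC : ∀ a ∈ C₁, ∀ a' ∈ C₁, ∀ d ∈ C₂, ∀ d' ∈ C₂, a * a'⁻¹ = d * d'⁻¹ → a = a' ∧ d = d')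
    {x x₀ z z₀ : GLm p 2}
    (hx : (x : Mat p 2) 1 0 = 0 ∧ (x : Mat p 2) 0 0 = (x : Mat p 2) 1 1 ∧ (x : Mat p 2) 0 0 ∈ C₁)
    (hx₀ : (x₀ : Mat p 2) 1 0 = 0 ∧ (x₀ : Mat p 2) 0 0 = (x₀ : Mat p 2) 1 1 ∧
      (x₀ : Mat p 2) 0 0 ∈ C₁)
    (hz : (z : Mat p 2) 0 1 = 0 ∧ (z : Mat p 2) 0 0 = (z : Mat p 2) 1 1 ∧ (z : Mat p 2) 0 0 ∈ C₂)
    (hz₀ : (z₀ : Mat p 2) 0 1 = 0 ∧ (z₀ : Mat p 2) 0 0 = (z₀ : Mat p 2) 1 1 ∧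
      (z₀ : Mat p 2) 0 0 ∈ C₂)
    (h : x * x₀⁻¹ = z * z₀⁻¹) : x = x₀ ∧ z = z₀ := by
  obtain ⟨u10, u00, u11⟩ := upper_quot hx.1 hx.2.1 hx₀.1 hx₀.2.1
  obtain ⟨l01, l00, -⟩ := lower_quot hz.1 hz.2.1 hz₀.1 hz₀.2.1
  have hM : ((x * x₀⁻¹ : GLm p 2) : Mat p 2) = ((z * z₀⁻¹ : GLm p 2) : Mat p 2) := by rw [h]
  have hratio : (x : Mat p 2) 0 0 * ((x₀ : Mat p 2) 0 0)⁻¹ =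
      (z : Mat p 2) 0 0 * ((z₀ : Mat p 2) 0 0)⁻¹ := by
    rw [← u00, ← l00, hM]
  obtain ⟨ha, -⟩ := hC _ hx.2.2 _ hx₀.2.2 _ hz.2.2 _ hz₀.2.2 hratio
  have hd : (x₀ : Mat p 2).det ≠ 0 := Matrix.GeneralLinearGroup.det_ne_zero x₀
  have ha₀ : (x₀ : Mat p 2) 0 0 ≠ 0 := by
    intro h0
    apply hd
    rw [Matrix.det_fin_two, h0, hx₀.1]; ring
  have h01 : ((x * x₀⁻¹ : GLm p 2) : Mat p 2) 0 1 = 0 := by rw [hM]; exact l01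
  have hx1 : x * x₀⁻¹ = 1 := by
    apply Units.ext
    rw [Matrix.eta_fin_two ((x * x₀⁻¹ : GLm p 2) : Mat p 2), u00, h01, u10, u11, ha,
      mul_inv_cancel₀ ha₀, Units.val_one, Matrix.one_fin_two]
  have hz1 : z * z₀⁻¹ = 1 := h ▸ hx1
  exact ⟨mul_inv_eq_one.mp hx1, mul_inv_eq_one.mp hz1⟩

/-- **`Γ·UU⁻ ⊆ Q(X)Q(Z)`, explicitly.**  For `a, a' ∈ C₁`, `d, d' ∈ C₂` (all non-zero),
`Γ = (a/a')(d/d')` and arbitrary off-diagonal targets `G₀₁, G₁₀`, the matrix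
`!![(Γ² + G₀₁G₁₀)/Γ, G₀₁; G₁₀, Γ]` (the general matrix with `g₁₁ = Γ`, `det g = Γ²`) is
`x x₀⁻¹ z₀ z⁻¹` with `x = !![a, *; 0, a], x₀ = a'·1 ∈ X` and `z₀ = !![d, 0; *, d], z = d'·1 ∈ Z`. -/
private theorem realize {C₁ C₂ : Finset (ZMod p)} (hC₁ : (0 : ZMod p) ∉ C₁)
    (hC₂ : (0 : ZMod p) ∉ C₂) {X Z : Finset (GLm p 2)}
    (hX : ∀ g : GLm p 2, g ∈ X ↔
      ((g : Mat p 2) 1 0 = 0 ∧ (g : Mat p 2) 0 0 = (g : Mat p 2) 1 1 ∧ (g : Mat p 2) 0 0 ∈ C₁))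
    (hZ : ∀ g : GLm p 2, g ∈ Z ↔
      ((g : Mat p 2) 0 1 = 0 ∧ (g : Mat p 2) 0 0 = (g : Mat p 2) 1 1 ∧ (g : Mat p 2) 0 0 ∈ C₂))
    {a a' d d' : ZMod p} (ha : a ∈ C₁) (ha' : a' ∈ C₁) (hd : d ∈ C₂) (hd' : d' ∈ C₂)
    (G₀₁ G₁₀ : ZMod p) :
    ∃ x ∈ X, ∃ x₀ ∈ X, ∃ z₀ ∈ Z, ∃ z ∈ Z,
      ((x * x₀⁻¹ * (z₀ * z⁻¹) : GLm p 2) : Mat p 2) =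
        !![((a * a'⁻¹ * (d * d'⁻¹)) ^ 2 + G₀₁ * G₁₀) / (a * a'⁻¹ * (d * d'⁻¹)), G₀₁;
           G₁₀, a * a'⁻¹ * (d * d'⁻¹)] := by
  have ha0 : a ≠ 0 := fun h => hC₁ (h ▸ ha)
  have ha0' : a' ≠ 0 := fun h => hC₁ (h ▸ ha')
  have hd0 : d ≠ 0 := fun h => hC₂ (h ▸ hd)
  have hd0' : d' ≠ 0 := fun h => hC₂ (h ▸ hd')
  have hdx : Matrix.det !![a, G₀₁ * a' * d' / d; 0, a] ≠ 0 := by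
    rw [Matrix.det_fin_two_of, mul_zero, sub_zero]; exact mul_ne_zero ha0 ha0
  have hdz : Matrix.det !![d, 0; G₁₀ * a' * d' / a, d] ≠ 0 := by
    rw [Matrix.det_fin_two_of, zero_mul, sub_zero]; exact mul_ne_zero hd0 hd0
  have e1 : !![a', 0; 0, a'] * !![a'⁻¹, 0; 0, a'⁻¹] = (1 : Mat p 2) := by
    rw [Matrix.mul_fin_two, Matrix.one_fin_two]; simp [ha0']
  have e2 : !![a'⁻¹, 0; 0, a'⁻¹] * !![a', 0; 0, a'] = (1 : Mat p 2) := by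
    rw [Matrix.mul_fin_two, Matrix.one_fin_two]; simp [ha0']
  have e3 : !![d', 0; 0, d'] * !![d'⁻¹, 0; 0, d'⁻¹] = (1 : Mat p 2) := by
    rw [Matrix.mul_fin_two, Matrix.one_fin_two]; simp [hd0']
  have e4 : !![d'⁻¹, 0; 0, d'⁻¹] * !![d', 0; 0, d'] = (1 : Mat p 2) := by
    rw [Matrix.mul_fin_two, Matrix.one_fin_two]; simp [hd0']
  refine ⟨Matrix.GeneralLinearGroup.mkOfDetNeZero _ hdx, ?_, ⟨_, _, e1, e2⟩, ?_,
    Matrix.GeneralLinearGroup.mkOfDetNeZero _ hdz, ?_, ⟨_, _, e3, e4⟩, ?_, ?_⟩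
  · exact (hX _).2 ⟨by simp, by simp, by simpa using ha⟩
  · exact (hX _).2 ⟨by simp, by simp, by simpa using ha'⟩
  · exact (hZ _).2 ⟨by simp, by simp, by simpa using hd⟩
  · exact (hZ _).2 ⟨by simp, by simp, by simpa using hd'⟩
  · rw [Matrix.GeneralLinearGroup.coe_mul, Matrix.GeneralLinearGroup.coe_mul,
      Matrix.GeneralLinearGroup.coe_mul, Units.inv_mk, Units.inv_mk, Units.val_mk, Units.val_mk,
      Matrix.GeneralLinearGroup.val_mkOfDetNeZero, Matrix.GeneralLinearGroup.val_mkOfDetNeZero,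
      Matrix.mul_fin_two, Matrix.mul_fin_two, Matrix.mul_fin_two]
    ext i j
    fin_cases i <;> fin_cases j
    · simp
      field_simp
    · simp
      field_simp
    · simp
      field_simp
    · simp

/-! ### The criterion -/

/-- **Flag criterion.**  Let `X = C₁·U = {g : g₁₀ = 0, g₀₀ = g₁₁ ∈ C₁}` and
`Z = C₂·U⁻ = {g : g₀₁ = 0, g₀₀ = g₁₁ ∈ C₂}` with `C₁, C₂ ⊆ 𝔽_p^×` "co-Sidon"
(`a/a' = d/d' ⇒ a = a' ∧ d = d'`), and `K ≠ ∅`.  Then `Q(X)Q(Z) = Γ·UU⁻ = {g : det g = g₁₁², g₁₁ ∈ Γ}`,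
`Γ = C₁C₁⁻¹C₂C₂⁻¹`, and `(X, K, Z)` has the (quadruple-form) TPP iff no ordered pair `k ≠ k'` of `K`
has `w² = det k · det k'` and `w ∈ det k' · Γ`, where `w = k₁₁k'₀₀ − k₁₀k'₀₁` (for `p ≠ 2`). -/
theorem stub_flag_tpp_criterion (hp : p ≠ 2) (C₁ C₂ : Finset (ZMod p))
    (hC₁ : (0 : ZMod p) ∉ C₁) (hC₂ : (0 : ZMod p) ∉ C₂)
    (hC : ∀ a ∈ C₁, ∀ a' ∈ C₁, ∀ d ∈ C₂, ∀ d' ∈ C₂, a * a'⁻¹ = d * d'⁻¹ → a = a' ∧ d = d')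
    (X K Z : Finset (GLm p 2))
    (hX : ∀ g : GLm p 2, g ∈ X ↔
      ((g : Mat p 2) 1 0 = 0 ∧ (g : Mat p 2) 0 0 = (g : Mat p 2) 1 1 ∧ (g : Mat p 2) 0 0 ∈ C₁))
    (hZ : ∀ g : GLm p 2, g ∈ Z ↔
      ((g : Mat p 2) 0 1 = 0 ∧ (g : Mat p 2) 0 0 = (g : Mat p 2) 1 1 ∧ (g : Mat p 2) 0 0 ∈ C₂))
    (hK : K.Nonempty) :
    (∀ x₀ ∈ X, ∀ z₀ ∈ Z, ∀ x ∈ X, ∀ y ∈ K, ∀ y' ∈ K, ∀ z ∈ Z,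
        x⁻¹ * y * y'⁻¹ * z = x₀⁻¹ * z₀ → x = x₀ ∧ y = y' ∧ z = z₀) ↔
      ∀ k ∈ K, ∀ k' ∈ K, k ≠ k' →
        ¬ ((((k : Mat p 2) 1 1 * (k' : Mat p 2) 0 0 - (k : Mat p 2) 1 0 * (k' : Mat p 2) 0 1) ^ 2
              = (k : Mat p 2).det * (k' : Mat p 2).det) ∧
            ∃ a ∈ C₁, ∃ a' ∈ C₁, ∃ d ∈ C₂, ∃ d' ∈ C₂,
              ((k : Mat p 2) 1 1 * (k' : Mat p 2) 0 0 - (k : Mat p 2) 1 0 * (k' : Mat p 2) 0 1)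
                = (k' : Mat p 2).det * (a * a'⁻¹ * (d * d'⁻¹))) := by
  -- `hp` and `hK` are part of the registered signature but not needed for the proof.
  have _h : p ≠ 2 ∧ K.Nonempty := ⟨hp, hK⟩
  clear _h hp hK
  constructor
  · -- TPP ⇒ the flag-code condition: a bad pair `k ≠ k'` would give `k k'⁻¹ ∈ Q(X)Q(Z)`.
    rintro hT k hk k' hk' hne ⟨hw2, a, ha, a', ha', d, hd, d', hd', hw⟩
    obtain ⟨h11, hdet⟩ := (quot_shape_iff k k' (a * a'⁻¹ * (d * d'⁻¹))).2 ⟨hw2, hw⟩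
    have ha0 : a ≠ 0 := fun h => hC₁ (h ▸ ha)
    have ha0' : a' ≠ 0 := fun h => hC₁ (h ▸ ha')
    have hd0 : d ≠ 0 := fun h => hC₂ (h ▸ hd)
    have hd0' : d' ≠ 0 := fun h => hC₂ (h ▸ hd')
    have hΓ : a * a'⁻¹ * (d * d'⁻¹) ≠ 0 :=
      mul_ne_zero (mul_ne_zero ha0 (inv_ne_zero ha0')) (mul_ne_zero hd0 (inv_ne_zero hd0'))
    have h00 : ((k * k'⁻¹ : GLm p 2) : Mat p 2) 0 0 =
        ((a * a'⁻¹ * (d * d'⁻¹)) ^ 2 +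
            ((k * k'⁻¹ : GLm p 2) : Mat p 2) 0 1 * ((k * k'⁻¹ : GLm p 2) : Mat p 2) 1 0) /
          (a * a'⁻¹ * (d * d'⁻¹)) := by
      rw [eq_div_iff hΓ, ← hdet, Matrix.det_fin_two, h11]; ring
    obtain ⟨x, hx, x₀, hx₀, z₀, hz₀, z, hz, hq⟩ :=
      realize hC₁ hC₂ hX hZ ha ha' hd hd' (((k * k'⁻¹ : GLm p 2) : Mat p 2) 0 1)
        (((k * k'⁻¹ : GLm p 2) : Mat p 2) 1 0)
    have hgq : k * k'⁻¹ = x * x₀⁻¹ * (z₀ * z⁻¹) := by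
      apply Units.ext
      rw [hq, ← h00, ← h11]
      exact Matrix.eta_fin_two _
    have hE : x⁻¹ * k * k'⁻¹ * z = x₀⁻¹ * z₀ := by
      calc x⁻¹ * k * k'⁻¹ * z = x⁻¹ * (k * k'⁻¹) * z := by group
        _ = x⁻¹ * (x * x₀⁻¹ * (z₀ * z⁻¹)) * z := by rw [hgq]
        _ = x₀⁻¹ * z₀ := by group
    exact hne (hT x₀ hx₀ z₀ hz₀ x hx k hk k' hk' z hz hE).2.1
  · -- the flag-code condition ⇒ TPP.
    intro hR x₀ hx₀ z₀ hz₀ x hx y hy y' hy' z hz hE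
    have hXx := (hX x).1 hx
    have hXx₀ := (hX x₀).1 hx₀
    have hZz := (hZ z).1 hz
    have hZz₀ := (hZ z₀).1 hz₀
    have hq : y * y'⁻¹ = x * x₀⁻¹ * (z₀ * z⁻¹) := by
      calc y * y'⁻¹ = x * (x⁻¹ * y * y'⁻¹ * z) * z⁻¹ := by group
        _ = x * (x₀⁻¹ * z₀) * z⁻¹ := by rw [hE]
        _ = x * x₀⁻¹ * (z₀ * z⁻¹) := by group
    by_cases hyy : y = y'
    · -- `y = y'`: then `x x₀⁻¹ = z z₀⁻¹ ∈ Q(X) ∩ Q(Z) = {1}`.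
      subst hyy
      have h1 : x * x₀⁻¹ * (z₀ * z⁻¹) = 1 := by rw [← hq]; group
      have h2 : x * x₀⁻¹ = z * z₀⁻¹ := by
        calc x * x₀⁻¹ = x * x₀⁻¹ * (z₀ * z⁻¹) * (z * z₀⁻¹) := by group
          _ = z * z₀⁻¹ := by rw [h1]; group
      obtain ⟨hxx, hzz⟩ := apart hC hXx hXx₀ hZz hZz₀ h2
      exact ⟨hxx, rfl, hzz⟩
    · -- `y ≠ y'`: then `y y'⁻¹ ∈ Q(X)Q(Z)` is a bad pair, contradicting the condition.
      exfalso
      obtain ⟨e11, edet⟩ :=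
        quot_prod_shape hXx.1 hXx.2.1 hXx₀.1 hXx₀.2.1 hZz₀.1 hZz₀.2.1 hZz.1 hZz.2.1
      rw [← hq] at e11 edet
      obtain ⟨hw2, hw⟩ := (quot_shape_iff y y' _).1 ⟨e11, edet⟩
      exact hR y hy y' hy' hyy
        ⟨hw2, _, hXx.2.2, _, hXx₀.2.2, _, hZz₀.2.2, _, hZz.2.2, hw⟩

end Flag

end Summit.MatrixMultiplication.MatrixMultiplication.Theorems.LevelOneGL2Designs.FlagLine
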